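import Literature.MathematicalPhysics.QuantumFieldTheory.BalabanImbrieJaffe1984to88.BIJ85Eq5113Proof
import Literature.MathematicalPhysics.QuantumFieldTheory.Balaban1983to89.B5HierAxialGaugeV1

/-!
# `BalabanImbrieJaffe1984to88.BIJ85Eq5113HierAxialBridge` — T. Bałaban, J. Imbrie, A. Jaffe, *Renormalization of the Higgs model:
minimizers, propagators and the stability of mean field theory*, Commun. Math. Phys. **97** (1985) 299–329 [BalabanImbrieJaffe1985],
(5.1.9)/(5.1.13) pp. 314–315, AND T. Bałaban, *Propagators and renormalization transformations for lattice gauge theories. I*, Commun.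
Math. Phys. **95** (1984) 17–40 [Balaban1984PropagatorsI], (1.23) p. 21: **the BRIDGE between the two gauge fixings of the residual
group `N(Q′_k)`** proved on the same V1 carriers — Bałaban's unique restricted gauge transformation of (1.23) (tree:
`…Balaban1983to89.B5HierAxialGaugeV1.hierAxial_existsUnique`, seat p37 gen 2) IS `−λ(A)`, `λ(A)` the gauge function (5.1.13) of
[BalabanImbrieJaffe1985] (tree: `…BIJ85GaugeFunction5113.lamOf`, `…BIJ85Eq5113Proof.existsUnique_gaugeFn`, seat p08 gen 2)

statement-level skeleton of published theorems with citation tags; proofs where landed; nothing here is a claim about the Yang–Mills mass gap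

PDF held: `paper:balaban1985-cmp97-bij-higgs-minimizers` (journal page = PDF page + 298; pp. 314–315 [PDF 16–17] read as images,
`run/shared/lean/pub/lit-balaban/lit-balaban-p08/renders/bij85-p016.png`, `…p017.png`); `paper:balaban1984-cmp95-propagators-rt-i`
(pp. 20–21 = PDF 4–5, the (1.17)/(1.23) displays as quoted in `B5HierAxialGaugeV1`'s header).

THE TWO PRINTED STATEMENTS.  [BalabanImbrieJaffe1985] p. 314: *"Making the gauge transformation A → A + ∂λ … In order to evaluate (5.1.9),
we solve the system of linear equations for λ which result from the delta functions δ(Q′_kλ) and δ_{k,Ax}(A + ∂λ). Using this value of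
λ = λ(A) …"* — kernel: `existsUnique_gaugeFn` (∃! λ, Q′_kλ = 0 ∧ δ_{k,Ax}(A + ∂λ)), the solution being (5.1.13) `lamOf c k A`.
[Balaban1984PropagatorsI] p. 20: *"The δ-function δ(B − Q_kA) is invariant with respect to gauge transformations λ satisfying Q′_kλ = 0
and we can look at the integral (1.17) as obtained by removing this gauge freedom by the help of the δ-functions δ_Ax"* (the λ′-integral
of `δ_Ax(Q_{k−1}A^{λ′})·…·δ_Ax(A^{λ′})` absorbed into `z′^{(k)}` in (1.23)) — kernel: `hierAxial_existsUnique` (∃! λ, Q′_kλ = 0 ∧ ∀ j < k,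
Q_jA^λ axial), with `A^λ = A − ∂λ` ((1.4), `gaugeShift`).  The two differ exactly by the sign convention of the gauge transformation:
`A^{−λ} = A + ∂λ`.

CITATION HEADER (lean-in-tree rule).  Phase-2 file of the lit-balaban TYPED SKELETON (HOME `run/shared/lean/pub/lit-balaban/`); rows
**`C1.Eq5.1.5-5.1.15`** (C1 owner r15) and **`B5.Eq1.23`** (B5 owner r02), cross-reference agreed in HOME/INBOX.md 2026-08-21T03:21:00Z
(p08 gen 2 overlap disclosure) / 03:32:21Z (r15 g3 ACK: *"p37 g2 `hierAxial_existsUnique` = decl of record for the bare ∃!; p08 g2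
`BIJ85Eq5113Proof` = decl of record for the BIJ85 displays (5.1.10)–(5.1.15) and the explicit λ; bridge (λ ↦ −λ) … once both oleans exist"*);
written by seat p08 gen 3 (unit `lit-balaban-p08`) as a separate file (the v1.1 append would push `BIJ85Eq5113Proof` past the 400-line
guideline and add a B5 import to it).  WHAT IS PROVED (standing range `k ≤ m + K`, lattice factor `c ≠ 0`, values in any real vector space):
`gaugeShift_neg` (`A^{−λ} = A + ∂λ`), the dictionary `deltaAx_iff_gaugeShift_neg`, `hierAxial_neg_lamOf` (`−λ(A)` satisfies Bałaban's two
conditions), **`eq_neg_lamOf_of_hierAxial`** (every λ satisfying them equals `−λ(A)` — proved THROUGH p37's `hierAxial_existsUnique`, and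
again inside (5.1.13)'s own uniqueness `eq5113`: `eq_neg_lamOf_of_hierAxial'`), `gaugeFn_iff_hierAxial_neg` (λ solves (5.1.9)'s system iff
−λ solves (1.23)'s — so each `∃!` is the other read through `λ ↦ −λ`; the two landed `∃!` theorems themselves are not restated), and the
data dictionary `axialData_eq_smul_contour` (p37's level-j block-axial data = `(L^j/c)·`the contour functional of (5.1.4)/(5.1.10)).  Theorems only;
no new definition, no new Prop-valued fact; nothing of either paper is asserted beyond these kernel-checked identities.
-/

namespace Literature.MathematicalPhysics.QuantumFieldTheory.BalabanImbrieJaffe1984to88.BIJ85Eq5113HierAxialBridge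

open Literature.MathematicalPhysics.QuantumFieldTheory.Balaban1983to89
open LatticeFieldCalculus B5Eq120IterProof BIJ85AxialPropagator411 BIJ85GaugeFunction5113 BIJ85Eq5113Proof B5HierAxialGaugeV1

variable {P : Params} {V : Type*} [AddCommGroup V] [Module ℝ V]

/-! ## §1  The sign dictionary `A^{−λ} = A + ∂λ` -/

/-- `A^{−λ} = A + ∂λ`: the abelian gauge transformation `A^λ = A − ∂λ` of [Balaban1984PropagatorsI] (1.4) (`gaugeShift`) taken at `−λ`
is the shift `A → A + ∂λ` of [BalabanImbrieJaffe1985] (5.1.8). [cite: BalabanImbrieJaffe1985, (5.1.8) p.314] -/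
theorem gaugeShift_neg {j : ℕ} (c : ℝ) (lam : SiteField P j V) (A : VecField P j V) :
    gaugeShift c (-lam) A = A + grad c lam := by
  funext b; simp only [gaugeShift, grad, Pi.add_apply, Pi.neg_apply]; module

/-- `A^{λ} = A + ∂(−λ)`. [cite: BalabanImbrieJaffe1985, (5.1.8) p.314] -/
theorem gaugeShift_eq_add_grad_neg {j : ℕ} (c : ℝ) (lam : SiteField P j V) (A : VecField P j V) :
    gaugeShift c lam A = A + grad c (-lam) := by
  rw [← gaugeShift_neg, neg_neg]

/-- DICTIONARY of the two gauge fixings on the V1 calculus: `δ_{k,Ax}(A + ∂λ)` of (5.1.9) ((4.1.2): all `Q_j(A + ∂λ)`, `j < k`, axial)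
is the statement that every `Q_jA^{−λ} = Q_j(A − ∂(−λ))`, `j < k`, is in the block axial gauge — the hierarchical condition of
[Balaban1984PropagatorsI] (1.17)/(1.23) for the restricted gauge transformation `−λ`. [cite: BalabanImbrieJaffe1985, (5.1.9) p.314] -/
theorem deltaAx_iff_gaugeShift_neg (k : ℕ) (c : ℝ) (lam : SiteField P 0 V) (A : VecField P 0 V) :
    deltaAx k (A + grad c lam) ↔ ∀ j, j < k → IsAxial (bondAvgIter j (gaugeShift c (-lam) A)) := by
  rw [gaugeShift_neg]; rfl

/-- `Q′_k(−λ) = −Q′_kλ`: the constraint `δ(Q′_kλ)` is symmetric under `λ ↦ −λ`. [cite: Balaban1984PropagatorsI, (1.20) p.20] -/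
theorem siteAvgIter_neg' (k : ℕ) (lam : SiteField P 0 V) : siteAvgIter k (-lam) = -siteAvgIter k lam := by
  rw [← neg_one_smul ℝ lam, siteAvgIter_smul, neg_one_smul]

/-- p37's block-axial DATA of level `j` are the contour functional of (5.1.4)/(5.1.10) up to the printed weight:
`axialData c A j = (L^j/c)·(Q_jA)(Γ_{x_{j+1},·}) = (L^j/c) • contour (Q_jA)` (`L^j/c = L^jη` in print).
[cite: BalabanImbrieJaffe1985, (5.1.10) p.315] -/
theorem axialData_eq_smul_contour {j : ℕ} (c : ℝ) (A : VecField P 0 V) :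
    axialData c A j = ((P.L : ℝ) ^ j / c) • contour (bondAvgIter j A) := by
  funext x
  simp only [axialData, contour, Pi.smul_apply, inv_div]

/-! ## §2  The bridge: Bałaban's unique hierarchical gauge is `−λ(A)` -/

/-- **`−λ(A)` IS A HIERARCHICAL BLOCK-AXIAL GAUGE in the sense of [Balaban1984PropagatorsI] (1.23):** `Q′_k(−λ(A)) = 0` and every
`Q_jA^{−λ(A)}`, `j < k`, is axial (standing range `k ≤ m + K`, `c ≠ 0`) — existence half of the bridge, from `siteAvgIter_lamOf` and
`deltaAx_lamOf`. [cite: BalabanImbrieJaffe1985, (5.1.13) p.315] -/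
theorem hierAxial_neg_lamOf {k : ℕ} (hk : k ≤ P.m + P.K) {c : ℝ} (hc : c ≠ 0) (A : VecField P 0 V) :
    siteAvgIter k (-lamOf c k A) = 0 ∧ ∀ j, j < k → IsAxial (bondAvgIter j (gaugeShift c (-lamOf c k A) A)) := by
  refine ⟨?_, (deltaAx_iff_gaugeShift_neg k c _ A).1 (deltaAx_lamOf hc k hk A)⟩
  rw [siteAvgIter_neg', siteAvgIter_lamOf c k hk A, neg_zero]

/-- **THE BRIDGE (uniqueness through p37's theorem):** every restricted gauge transformation `λ` with `Q′_kλ = 0` putting all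
`Q_jA^λ`, `j < k`, in the block axial gauge — the object whose existence and uniqueness is
`B5HierAxialGaugeV1.hierAxial_existsUnique` ([Balaban1984PropagatorsI] (1.23), middle term) — EQUALS `−λ(A)`, `λ(A)` = (5.1.13)
(`lamOf c k A`).  Proof: p37's uniqueness applied to `λ` and to the witness `−λ(A)` of `hierAxial_neg_lamOf`.
[cite: BalabanImbrieJaffe1985, (5.1.13) p.315] -/
theorem eq_neg_lamOf_of_hierAxial {k : ℕ} (hk : k ≤ P.m + P.K) {c : ℝ} (hc : c ≠ 0) {A : VecField P 0 V}
    {lam : SiteField P 0 V} (hnull : siteAvgIter k lam = 0)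
    (hax : ∀ j, j < k → IsAxial (bondAvgIter j (gaugeShift c lam A))) : lam = -lamOf c k A :=
  (hierAxial_existsUnique hk hc A).unique ⟨hnull, hax⟩ (hierAxial_neg_lamOf hk hc A)

/-- The same bridge proved through (5.1.13)'s OWN uniqueness `eq5113` read through the dictionary `deltaAx_iff_gaugeShift_neg` — the two
uniqueness theorems agree. [cite: BalabanImbrieJaffe1985, (5.1.13) p.315] -/
theorem eq_neg_lamOf_of_hierAxial' {k : ℕ} (hk : k ≤ P.m + P.K) {c : ℝ} (hc : c ≠ 0) {A : VecField P 0 V}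
    {lam : SiteField P 0 V} (hnull : siteAvgIter k lam = 0)
    (hax : ∀ j, j < k → IsAxial (bondAvgIter j (gaugeShift c lam A))) : lam = -lamOf c k A := by
  have hnull' : siteAvgIter k (-lam) = 0 := by rw [siteAvgIter_neg', hnull, neg_zero]
  have hax' : deltaAx k (A + grad c (-lam)) := by
    rw [deltaAx_iff_gaugeShift_neg, neg_neg]; exact hax
  have h := eq5113 hk hc hnull' hax'
  rw [← h, neg_neg]

/-- **The two `∃!` statements are one statement up to `λ ↦ −λ`:** (5.1.9)'s *"we solve the system of linear equations for λ which
result from the delta functions δ(Q′_kλ) and δ_{k,Ax}(A + ∂λ)"* (`existsUnique_gaugeFn`) and [Balaban1984PropagatorsI] (1.23)'s unique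
restricted gauge transformation (`B5HierAxialGaugeV1.hierAxial_existsUnique`) — for every `A`, `λ` solves the first system iff `−λ`
solves the second. [cite: BalabanImbrieJaffe1985, (5.1.9) p.314] -/
theorem gaugeFn_iff_hierAxial_neg (k : ℕ) (c : ℝ) (A : VecField P 0 V) (lam : SiteField P 0 V) :
    (siteAvgIter k lam = 0 ∧ deltaAx k (A + grad c lam)) ↔
      (siteAvgIter k (-lam) = 0 ∧ ∀ j, j < k → IsAxial (bondAvgIter j (gaugeShift c (-lam) A))) := by
  rw [deltaAx_iff_gaugeShift_neg, siteAvgIter_neg', neg_eq_zero]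

/-- The B5 gauge-fixed representative is this paper's `A + ∂λ(A)`: `A^{−λ(A)} = A + ∂λ(A)` (the axial field of (5.1.9), with
`Q_k(A + ∂λ(A)) = Q_kA` by `bondAvgIter_add_grad_lamOf`). [cite: BalabanImbrieJaffe1985, (5.1.9) p.314] -/
theorem gaugeShift_neg_lamOf (c : ℝ) (k : ℕ) (A : VecField P 0 V) :
    gaugeShift c (-lamOf c k A) A = A + grad c (lamOf c k A) :=
  gaugeShift_neg c _ A

/-- In particular the B5 representative keeps the k-fold average: `Q_k(A^{−λ(A)}) = Q_kA` (standing range).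
[cite: BalabanImbrieJaffe1985, (5.1.8) p.314] -/
theorem bondAvgIter_gaugeShift_neg_lamOf {k : ℕ} (hk : k ≤ P.m + P.K) (c : ℝ) (A : VecField P 0 V) :
    bondAvgIter k (gaugeShift c (-lamOf c k A) A) = bondAvgIter k A := by
  rw [gaugeShift_neg_lamOf, bondAvgIter_add_grad_lamOf hk]

end Literature.MathematicalPhysics.QuantumFieldTheory.BalabanImbrieJaffe1984to88.BIJ85Eq5113HierAxialBridge
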